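import Summits.QuantumFields.BalabanUV.Beta.GAN24.StaircaseLaplacianDefect
import Literature.MathematicalPhysics.QuantumFieldTheory.Balaban1983to89.B5LaplaceInverse

/-!
# G-an2-4 ∕ (CONV-C), road P2, route R2-S1 — THE MASSLESS BRICK: Bałaban's scalar pseudo-inverse `Δ⁻¹` (`B5LaplaceInverse.LapSinv`,
# value `0` on constants) against King's staircase, EXACTLY: `Δ′⁻¹(Jf) − J(Δ⁻¹f) = −Δ′⁻¹·(Δ′J − JΔ)·Δ⁻¹f` for EVERY `f` — the same
# shape as the soft minimiser's identity, with the zero modes taken care of by `J`'s fibre structure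

Unit `b2b-balaban-gan24-p2` (gen 29), BINDER row G-an2-4 ∕ (CONV-C), road P2.  Bałaban's position-space formula (1.81)∕(1.82) for the vector
propagator `G = Δ_a⁻¹` (lit-balaban's `B5Eq181GTorus.eq182`: `G182 = [Δ⁻¹ − aΔ⁻¹Q*φ⁻¹QΔ⁻¹](1 − P₀) + […]*a⁻¹(∂₁*φ⁻¹∂₁)⁻¹[…](1 − P₀) + a⁻¹P₀`)
and his `P = Δ⁻¹Q′*(Q′Δ⁻²Q′*)⁻¹Q′Δ⁻¹` ((1.26)∕(1.70), the `∂P∂*` term of `Δ_a`) are built from the componentwise scalar pseudo-inverse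
`Δ⁻¹ = LapSinv` (and unit-lattice inverses).  THIS FILE is the two-level identity of that brick:
 * §1 `sum_stair_mulVec` (`Σ_{x′}(Ju)(x′) = R^d·Σ_x u(x)`), `Pker_stair_LapSinv` (`P′_ker(J(Δ⁻¹f)) = 0`: `J` of a mean-zero field is
   mean-zero), `LapSinv_stair_Pker` (`Δ′⁻¹(J(P_ker f)) = 0`: `J` of a constant is constant);
 * §2 **`LapSinv_succ_sub_stair`** — `Δ′⁻¹(Jf) − J(Δ⁻¹f) = −Δ′⁻¹·(Δ′(Ju) − J(Δu))`, `u = Δ⁻¹f`, for EVERY `f` (no orthogonality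
   hypothesis), and **`LapSinv_succ_sub_stair_eq_sum`** — its second-order form through `StaircaseLaplacianDefect.LapS_stair_defect`:
   `= −Δ′⁻¹·Σ_μ ∂′_μᴴ(∂′_μᴴ(π^L_μ·J∂_μu) + π^F_μ·J∂_μᴴ∂_μu)`.
HONEST SCOPE.  Exact finite-lattice algebra, every `d`, `N, R ≥ 1`, every torus; [folklore], kernel-checked, no `sorry`, no `def`; the MASSLESS
pseudo-inverse has NO volume-uniform sup letters of its own (the kernel `|x|^{2−d}` is not summable at infinity) — this identity is a BRICK for
the assembled `G182`, not a one-step law by itself.  Nothing of Bałaban's asserted ([Balaban1984PropagatorsI] Sect. C p. 22, (1.26) p. 22, (1.81)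
p. 31 are TEXT LOCATIONS).  NOT (CONV-C), NEVER «G-an2-4 closed», NOT NE2, NOT D1, NOT BetaPertH, NOT continuum, NOT Clay; not in print — our
bookkeeping.  HONEST DEPENDENCY: continuum YM on T⁴ ⇐ BetaPertH ∧ nine spine estimates (0/9 proved); BetaPertH ⇐ (D1) ∧ (D4) ∧ CAP+tail;
G-an2-4 gates asym, D1 and NE2/3/4.
-/

noncomputable section

open scoped BigOperators ComplexConjugate Matrix

namespace Summit.QuantumFields.BalabanUV.Beta.GAN24.LaplaceInverseStaircase

open Literature.MathematicalPhysics.QuantumFieldTheory.Balaban1983to89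
open B5Prop11Plancherel (Tor fine)
open B5Action121 (sdiff LapS)
open B5LaplaceInverse (LapSinv Pker LapS_mul_LapSinv LapSinv_mul_LapS Pker_const Pker_orth LapSinv_const sum_LapSinv)
open Summit.QuantumFields.BalabanUV.T4Continuum.BalabanAveragedTowerModes (par par_cpt_add_off)
open Summit.QuantumFields.BalabanUV.T4Continuum.ScalarBlockPlanting (sum_fine_eq_sum_tile)
open Summit.QuantumFields.BalabanUV.Beta.GAN24.StaircaseLaplacianDefect (stair stair_mulVec piL piF LapS_stair_defect)

variable {d : ℕ} (N R : ℕ) [NeZero N] [NeZero R] (M : Fin d → ℕ) [hM : ∀ μ, NeZero (M μ)]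

/-! ## §1 The staircase and the zero modes -/

/-- **`Σ_{x′}(Ju)(x′) = R^d·Σ_x u(x)`**: every coarse site has `R^d` fine sites above it. [folklore] -/
theorem sum_stair_mulVec (u : Tor (fine N M) → ℂ) : ∑ x', (stair N R M *ᵥ u) x' = ((R : ℂ) ^ d) * ∑ x, u x := by
  have hcard : (Finset.univ : Finset (Fin d → Fin R)).card = R ^ d := by
    rw [Finset.card_univ, Fintype.card_fun, Fintype.card_fin, Fintype.card_fin]
  rw [sum_fine_eq_sum_tile N R M, Finset.mul_sum]
  refine Finset.sum_congr rfl fun x _ => ?_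
  simp only [stair_mulVec, par_cpt_add_off, Finset.sum_const, hcard, nsmul_eq_mul]
  push_cast
  ring

/-- `J(Δ⁻¹f)` has no zero mode: `P′_ker(J(Δ⁻¹f)) = 0`. [folklore] -/
theorem Pker_stair_LapSinv (f : Tor (fine N M) → ℂ) :
    Pker (fine (R * N) M) ((R * N : ℕ) : ℂ) *ᵥ (stair N R M *ᵥ (LapSinv (fine N M) ((N : ℕ) : ℂ) *ᵥ f)) = 0 := by
  have hRN : ((R * N : ℕ) : ℂ) ≠ 0 := by exact_mod_cast (Nat.mul_pos (Nat.pos_of_ne_zero (NeZero.ne R))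
    (Nat.pos_of_ne_zero (NeZero.ne N))).ne'
  refine Pker_orth _ hRN _ ?_
  rw [sum_stair_mulVec, sum_LapSinv, mul_zero]

/-- `Δ′⁻¹` kills `J` of the zero mode: `Δ′⁻¹(J(P_ker f)) = 0`. [folklore] -/
theorem LapSinv_stair_Pker (f : Tor (fine N M) → ℂ) :
    LapSinv (fine (R * N) M) ((R * N : ℕ) : ℂ) *ᵥ (stair N R M *ᵥ (Pker (fine N M) ((N : ℕ) : ℂ) *ᵥ f)) = 0 := by
  have hN : ((N : ℕ) : ℂ) ≠ 0 := by exact_mod_cast NeZero.ne N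
  have hconst : stair N R M *ᵥ (Pker (fine N M) ((N : ℕ) : ℂ) *ᵥ f) = fun _ => (Pker (fine N M) ((N : ℕ) : ℂ) *ᵥ f) 0 := by
    funext x'; rw [stair_mulVec, Pker_const _ hN]
  rw [hconst, LapSinv_const]

/-! ## §2 The two-level identity of `Δ⁻¹` -/

/-- **`Δ′⁻¹(Jf) − J(Δ⁻¹f) = −Δ′⁻¹·(Δ′(Ju) − J(Δu))`, `u = Δ⁻¹f`, for EVERY `f`.** [folklore] -/
theorem LapSinv_succ_sub_stair (f : Tor (fine N M) → ℂ) :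
    LapSinv (fine (R * N) M) ((R * N : ℕ) : ℂ) *ᵥ (stair N R M *ᵥ f)
        - stair N R M *ᵥ (LapSinv (fine N M) ((N : ℕ) : ℂ) *ᵥ f)
      = -(LapSinv (fine (R * N) M) ((R * N : ℕ) : ℂ) *ᵥ
          (LapS (fine (R * N) M) ((R * N : ℕ) : ℂ) *ᵥ (stair N R M *ᵥ (LapSinv (fine N M) ((N : ℕ) : ℂ) *ᵥ f))
            - stair N R M *ᵥ (LapS (fine N M) ((N : ℕ) : ℂ) *ᵥ (LapSinv (fine N M) ((N : ℕ) : ℂ) *ᵥ f)))) := by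
  -- `Δu = f − P_ker f`
  have h1 : LapS (fine N M) ((N : ℕ) : ℂ) *ᵥ (LapSinv (fine N M) ((N : ℕ) : ℂ) *ᵥ f) = f - Pker (fine N M) ((N : ℕ) : ℂ) *ᵥ f := by
    rw [Matrix.mulVec_mulVec, LapS_mul_LapSinv, Matrix.sub_mulVec, Matrix.one_mulVec]
  -- `Δ′⁻¹Δ′(Ju) = Ju − P′_ker(Ju) = Ju`
  have h2 : LapSinv (fine (R * N) M) ((R * N : ℕ) : ℂ) *ᵥ
        (LapS (fine (R * N) M) ((R * N : ℕ) : ℂ) *ᵥ (stair N R M *ᵥ (LapSinv (fine N M) ((N : ℕ) : ℂ) *ᵥ f)))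
      = stair N R M *ᵥ (LapSinv (fine N M) ((N : ℕ) : ℂ) *ᵥ f) := by
    rw [Matrix.mulVec_mulVec, LapSinv_mul_LapS, Matrix.sub_mulVec, Matrix.one_mulVec, Pker_stair_LapSinv, sub_zero]
  rw [Matrix.mulVec_sub (LapSinv (fine (R * N) M) ((R * N : ℕ) : ℂ)), h2, h1, Matrix.mulVec_sub (stair N R M),
    Matrix.mulVec_sub (LapSinv (fine (R * N) M) ((R * N : ℕ) : ℂ)), LapSinv_stair_Pker, sub_zero]
  abel

/-- **THE TWO-LEVEL IDENTITY OF `Δ⁻¹`, SECOND-ORDER FORM**: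
`Δ′⁻¹(Jf) − J(Δ⁻¹f) = −Δ′⁻¹·Σ_μ ∂′_μᴴ(∂′_μᴴ(π^L_μ·J(∂_μu)) + π^F_μ·J(∂_μᴴ∂_μu))`, `u = Δ⁻¹f`. [folklore] -/
theorem LapSinv_succ_sub_stair_eq_sum (f : Tor (fine N M) → ℂ) :
    LapSinv (fine (R * N) M) ((R * N : ℕ) : ℂ) *ᵥ (stair N R M *ᵥ f)
        - stair N R M *ᵥ (LapSinv (fine N M) ((N : ℕ) : ℂ) *ᵥ f)
      = -(LapSinv (fine (R * N) M) ((R * N : ℕ) : ℂ) *ᵥ ∑ μ, (sdiff (fine (R * N) M) ((R * N : ℕ) : ℂ) μ)ᴴ *ᵥ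
          (((sdiff (fine (R * N) M) ((R * N : ℕ) : ℂ) μ)ᴴ *ᵥ
              (fun z => piL N R M μ z * (stair N R M *ᵥ (sdiff (fine N M) ((N : ℕ) : ℂ) μ *ᵥ
                (LapSinv (fine N M) ((N : ℕ) : ℂ) *ᵥ f))) z))
            + (fun z => piF N R M μ z * (stair N R M *ᵥ ((sdiff (fine N M) ((N : ℕ) : ℂ) μ)ᴴ *ᵥ
                (sdiff (fine N M) ((N : ℕ) : ℂ) μ *ᵥ (LapSinv (fine N M) ((N : ℕ) : ℂ) *ᵥ f)))) z))) := by
  rw [LapSinv_succ_sub_stair, LapS_stair_defect]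

end Summit.QuantumFields.BalabanUV.Beta.GAN24.LaplaceInverseStaircase

end
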